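import Mathlib
import Summits.Ventures.PercRepro2.Defs
import Summits.Ventures.PercRepro2.Graph
import Summits.Ventures.PercRepro2.OneColourSwitch
import Summits.Ventures.PercRepro2.RegionHubSign
import Summits.Ventures.PercRepro2.SideSwitch
import Summits.Ventures.PercRepro2.SideSwitchComps
import Summits.Ventures.PercRepro2.M9NoPocketDefs
import Summits.Ventures.PercRepro2.M9NoPocketWorldD
import Summits.Ventures.PercRepro2.M9GeneralDSplit
import Summits.Ventures.PercRepro2.M9GeneralDHD
import Summits.Ventures.PercRepro2.M9PocketUnitKonly
import Summits.Ventures.PercRepro2.M9PocketProdSum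
import Summits.Ventures.PercRepro2.M9PocketProdFam
import Summits.Ventures.PercRepro2.M9PocketProdAssembly
import Summits.Ventures.PercRepro2.M9PocketUnitFibreSumT
import Summits.Ventures.PercRepro2.M9PocketProdPointT
import Summits.Ventures.PercRepro2.M9PocketProdWorldsT
import Summits.Ventures.PercRepro2.M9PocketProdMonoT
import Summits.Ventures.PercRepro2.M9PocketProdSumT
import Summits.Ventures.PercRepro2.M9PocketProdPartitionT
import Summits.Ventures.PercRepro2.M9PocketProdWsideFamT
import Summits.Ventures.PercRepro2.M9PocketProdAssemblyT

/-!
# [`T`-edge chain] The `Y`-side sub-cube of a skeleton with linking blocks (blind cell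
PercRepro2, p3 g40, 2026-08-29; `proofs/P3-POCKETRK.md` §10⁗ (f): the linking free blocks,
step A)

A skeleton `ρ` may carry LINKING switchable blocks (free components of the sided set of `G − d`
adjacent to both `r` and `s`); on the product fibre `σ_rs` then changes sign with their side and
the cube Harris of `M9PocketProdSumT` does not apply to the whole fibre.  It does apply to the
SUB-CUBE on which every linking block stays on the `Y`-side: the points of the fibre whose
`W`-side contains no linking block are indexed by the subsets of the NON-LINKING blocks and the
free edges (the family `(fam ρ).filter nonlinking` satisfies every hypothesis of the chain, with
`h𝔉nl` by construction), and their `HD`, `d ∈ K₂` sum is `≤ 0` (`sum_skel_subcube_nonpos_T`).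
This is the `A ≤ 0` half of the decomposition `A + B + ATT` of §10⁗ (f); `T`-edges arbitrary.
Own work; std axioms.
-/

namespace Summit.Ventures.PercRepro2

namespace NoPocket

open Finset Classical OneColourSwitch SideSwitch

variable {V : Type*} {E : Type*} {ends : E → Sym2 V} {p q r s d : V}

section FamNL

variable [Fintype V] [DecidableEq V] {ρ : Config E}

/-- A non-linking switchable block is a switchable block. -/
lemma famNL_mem_fam : ∀ C ∈ ((comps (endsD ends d) r s ρ).filter (fun C =>
      (∀ e y, y ∈ C → ends e ≠ s(d, y)) ∧ ∀ e x y, ends e = s(x, y) → x ∈ C →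
        y ∈ cluster ends ρ d → y ∈ C ∨ y = r ∨ y = s)).filter (fun C =>
      (∀ e y, y ∈ C → ends e ≠ s(r, y)) ∨ (∀ e y, y ∈ C → ends e ≠ s(s, y))), C ∈ (comps (endsD ends d) r s ρ).filter (fun C =>
      (∀ e y, y ∈ C → ends e ≠ s(d, y)) ∧ ∀ e x y, ends e = s(x, y) → x ∈ C →
        y ∈ cluster ends ρ d → y ∈ C ∨ y = r ∨ y = s) :=
  fun _ hC => (Finset.mem_filter.1 hC).1

/-- A non-linking switchable block is a component of the sided set. -/
lemma famNL_mem_comps : ∀ C ∈ ((comps (endsD ends d) r s ρ).filter (fun C =>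
      (∀ e y, y ∈ C → ends e ≠ s(d, y)) ∧ ∀ e x y, ends e = s(x, y) → x ∈ C →
        y ∈ cluster ends ρ d → y ∈ C ∨ y = r ∨ y = s)).filter (fun C =>
      (∀ e y, y ∈ C → ends e ≠ s(r, y)) ∨ (∀ e y, y ∈ C → ends e ≠ s(s, y))), C ∈ comps (endsD ends d) r s ρ :=
  fun C hC => (Finset.mem_filter.1 (famNL_mem_fam C hC)).1

/-- The non-linking switchable blocks lie in the `Y`-world of `G − d`. -/
lemma famNL_subset_K2 (hB : ∀ x ∈ M2 (endsD ends d) r s ρ, x = r ∨ x = s) :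
    ∀ C ∈ ((comps (endsD ends d) r s ρ).filter (fun C =>
      (∀ e y, y ∈ C → ends e ≠ s(d, y)) ∧ ∀ e x y, ends e = s(x, y) → x ∈ C →
        y ∈ cluster ends ρ d → y ∈ C ∨ y = r ∨ y = s)).filter (fun C =>
      (∀ e y, y ∈ C → ends e ≠ s(r, y)) ∨ (∀ e y, y ∈ C → ends e ≠ s(s, y))), (↑C : Set V) ⊆ K2 (endsD ends d) r s ρ :=
  fun C hC => fam_subset_K2 hB C (famNL_mem_fam C hC)

/-- `r` is in no non-linking switchable block. -/
lemma famNL_notMem_r : ∀ C ∈ ((comps (endsD ends d) r s ρ).filter (fun C =>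
      (∀ e y, y ∈ C → ends e ≠ s(d, y)) ∧ ∀ e x y, ends e = s(x, y) → x ∈ C →
        y ∈ cluster ends ρ d → y ∈ C ∨ y = r ∨ y = s)).filter (fun C =>
      (∀ e y, y ∈ C → ends e ≠ s(r, y)) ∨ (∀ e y, y ∈ C → ends e ≠ s(s, y))), r ∉ C :=
  fun C hC => fam_notMem_r C (famNL_mem_fam C hC)

/-- `s` is in no non-linking switchable block. -/
lemma famNL_notMem_s : ∀ C ∈ ((comps (endsD ends d) r s ρ).filter (fun C =>
      (∀ e y, y ∈ C → ends e ≠ s(d, y)) ∧ ∀ e x y, ends e = s(x, y) → x ∈ C →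
        y ∈ cluster ends ρ d → y ∈ C ∨ y = r ∨ y = s)).filter (fun C =>
      (∀ e y, y ∈ C → ends e ≠ s(r, y)) ∨ (∀ e y, y ∈ C → ends e ≠ s(s, y))), s ∉ C :=
  fun C hC => fam_notMem_s C (famNL_mem_fam C hC)

/-- A non-linking switchable block is closed in the sided set. -/
lemma famNL_closedIn : ∀ C ∈ ((comps (endsD ends d) r s ρ).filter (fun C =>
      (∀ e y, y ∈ C → ends e ≠ s(d, y)) ∧ ∀ e x y, ends e = s(x, y) → x ∈ C →
        y ∈ cluster ends ρ d → y ∈ C ∨ y = r ∨ y = s)).filter (fun C =>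
      (∀ e y, y ∈ C → ends e ≠ s(r, y)) ∨ (∀ e y, y ∈ C → ends e ≠ s(s, y))),
    ClosedIn (endsD ends d) (sided (endsD ends d) r s ρ) (↑C : Set V) :=
  fun C hC => fam_closedIn C (famNL_mem_fam C hC)

/-- A non-linking switchable block is free. -/
lemma famNL_free : ∀ C ∈ ((comps (endsD ends d) r s ρ).filter (fun C =>
      (∀ e y, y ∈ C → ends e ≠ s(d, y)) ∧ ∀ e x y, ends e = s(x, y) → x ∈ C →
        y ∈ cluster ends ρ d → y ∈ C ∨ y = r ∨ y = s)).filter (fun C =>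
      (∀ e y, y ∈ C → ends e ≠ s(r, y)) ∨ (∀ e y, y ∈ C → ends e ≠ s(s, y))), ∀ e y, y ∈ C → ends e ≠ s(d, y) :=
  fun C hC => fam_free C (famNL_mem_fam C hC)

/-- A non-linking switchable block is not attached to the cluster of `d`. -/
lemma famNL_pocket : ∀ C ∈ ((comps (endsD ends d) r s ρ).filter (fun C =>
      (∀ e y, y ∈ C → ends e ≠ s(d, y)) ∧ ∀ e x y, ends e = s(x, y) → x ∈ C →
        y ∈ cluster ends ρ d → y ∈ C ∨ y = r ∨ y = s)).filter (fun C =>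
      (∀ e y, y ∈ C → ends e ≠ s(r, y)) ∨ (∀ e y, y ∈ C → ends e ≠ s(s, y))),
    ∀ e x y, ends e = s(x, y) → x ∈ C → y ∈ cluster ends ρ d → y ∈ C ∨ y = r ∨ y = s :=
  fun C hC => fam_pocket C (famNL_mem_fam C hC)

/-- Distinct non-linking switchable blocks are disjoint. -/
lemma famNL_disjoint : ∀ C ∈ ((comps (endsD ends d) r s ρ).filter (fun C =>
      (∀ e y, y ∈ C → ends e ≠ s(d, y)) ∧ ∀ e x y, ends e = s(x, y) → x ∈ C →
        y ∈ cluster ends ρ d → y ∈ C ∨ y = r ∨ y = s)).filter (fun C =>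
      (∀ e y, y ∈ C → ends e ≠ s(r, y)) ∨ (∀ e y, y ∈ C → ends e ≠ s(s, y))), ∀ C' ∈ ((comps (endsD ends d) r s ρ).filter (fun C =>
      (∀ e y, y ∈ C → ends e ≠ s(d, y)) ∧ ∀ e x y, ends e = s(x, y) → x ∈ C →
        y ∈ cluster ends ρ d → y ∈ C ∨ y = r ∨ y = s)).filter (fun C =>
      (∀ e y, y ∈ C → ends e ≠ s(r, y)) ∨ (∀ e y, y ∈ C → ends e ≠ s(s, y))), C ≠ C' → Disjoint C C' :=
  fun C hC C' hC' => fam_disjoint C (famNL_mem_fam C hC) C' (famNL_mem_fam C' hC')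

/-- A non-linking switchable block is non-empty. -/
lemma famNL_nonempty : ∀ C ∈ ((comps (endsD ends d) r s ρ).filter (fun C =>
      (∀ e y, y ∈ C → ends e ≠ s(d, y)) ∧ ∀ e x y, ends e = s(x, y) → x ∈ C →
        y ∈ cluster ends ρ d → y ∈ C ∨ y = r ∨ y = s)).filter (fun C =>
      (∀ e y, y ∈ C → ends e ≠ s(r, y)) ∨ (∀ e y, y ∈ C → ends e ≠ s(s, y))), C.Nonempty :=
  fun C hC => fam_nonempty C (famNL_mem_fam C hC)

/-- A non-linking switchable block is non-linking. -/
lemma famNL_nl : ∀ C ∈ ((comps (endsD ends d) r s ρ).filter (fun C =>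
      (∀ e y, y ∈ C → ends e ≠ s(d, y)) ∧ ∀ e x y, ends e = s(x, y) → x ∈ C →
        y ∈ cluster ends ρ d → y ∈ C ∨ y = r ∨ y = s)).filter (fun C =>
      (∀ e y, y ∈ C → ends e ≠ s(r, y)) ∨ (∀ e y, y ∈ C → ends e ≠ s(s, y))),
    (∀ e y, y ∈ C → ends e ≠ s(r, y)) ∨ (∀ e y, y ∈ C → ends e ≠ s(s, y)) :=
  fun _ hC => (Finset.mem_filter.1 hC).2

/-- **The `W`-side of a point without a `W`-side linking block is a union of non-linking
switchable blocks of its skeleton** (`wside_block_mem_fam_T` + the hypothesis). -/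
lemma famNL_mem_of_wside (hdr : d ≠ r) (hds : d ≠ s) {ω : Config E}
    (hsep : sep2 ends p q r s ω) (hD : DOne ends r s d ω) (hK : d ∈ K2 ends r s ω)
    (hM : d ∉ M2 ends r s ω)
    (hρ : ρ = fun e => if e ∈ touches ends
      (cluster ends (flipTouch (endsD ends d)
          {x : V | x ∈ M2 (endsD ends d) r s ω ∧ x ≠ r ∧ x ≠ s} ω) d ∪
        K2 (endsD ends d) r s (flipTouch (endsD ends d)
          {x : V | x ∈ M2 (endsD ends d) r s ω ∧ x ≠ r ∧ x ≠ s} ω) ∪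
        M2 (endsD ends d) r s (flipTouch (endsD ends d)
          {x : V | x ∈ M2 (endsD ends d) r s ω ∧ x ≠ r ∧ x ≠ s} ω)) then
        flipTouch (endsD ends d) {x : V | x ∈ M2 (endsD ends d) r s ω ∧ x ≠ r ∧ x ≠ s} ω e
      else false)
    (hNL : ∀ C ∈ comps (endsD ends d) r s ρ,
      (↑C : Set V) ⊆ {x : V | x ∈ M2 (endsD ends d) r s ω ∧ x ≠ r ∧ x ≠ s} →
      (∀ e y, y ∈ C → ends e ≠ s(r, y)) ∨ (∀ e y, y ∈ C → ends e ≠ s(s, y))) :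
    ∀ x ∈ {x : V | x ∈ M2 (endsD ends d) r s ω ∧ x ≠ r ∧ x ≠ s},
      ∃ C ∈ ((comps (endsD ends d) r s ρ).filter (fun C =>
      (∀ e y, y ∈ C → ends e ≠ s(d, y)) ∧ ∀ e x y, ends e = s(x, y) → x ∈ C →
        y ∈ cluster ends ρ d → y ∈ C ∨ y = r ∨ y = s)).filter (fun C =>
      (∀ e y, y ∈ C → ends e ≠ s(r, y)) ∨ (∀ e y, y ∈ C → ends e ≠ s(s, y))),
        x ∈ C ∧ (↑C : Set V) ⊆ {x : V | x ∈ M2 (endsD ends d) r s ω ∧ x ≠ r ∧ x ≠ s} := by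
  intro x hx
  obtain ⟨C, hC, hxC, hCW⟩ := wside_block_mem_fam_T hdr hds hsep hD hK hM hρ x hx
  exact ⟨C, Finset.mem_filter.2 ⟨hC, hNL C (Finset.mem_filter.1 hC).1 hCW⟩, hxC, hCW⟩

end FamNL

section Subcube

variable [Fintype V] [DecidableEq V] [Fintype E] [DecidableEq E]

/-- **The `Y`-side sub-cube theorem**: the `HD`, `d ∈ K₂` sum over the points with skeleton `ρ`
whose `W`-side contains no linking block (every component of the sided set of `ρ` inside the
`W`-side of the point is adjacent to at most one of `r`, `s`) is non-positive — no hypothesis on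
the linking blocks of `ρ`, which stay on the `Y`-side on this part of the fibre. -/
theorem sum_skel_subcube_nonpos_T (hdr : d ≠ r) (hds : d ≠ s)
    (hrs : within ends ({r, s} : Set V) = ∅)
    (hp : p ≠ d) (hq : q ≠ d) {ρ : Config E}
    (hsep : sep2 ends p q r s ρ) (hD : DOne ends r s d ρ) (hK : d ∈ K2 ends r s ρ)
    (hM : d ∉ M2 ends r s ρ)
    (hB : ∀ x ∈ M2 (endsD ends d) r s ρ, x = r ∨ x = s)
    (hρR : ∀ e ∉ touches ends (cluster ends ρ d ∪ K2 (endsD ends d) r s ρ ∪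
      M2 (endsD ends d) r s ρ), ρ e = false) :
    ∑ ω ∈ ((univ.filter (fun ω : Config E => HD ends p q r s d ω ∧ d ∈ K2 ends r s ω)).filter
        (fun ω => (fun e => if e ∈ touches ends
          (cluster ends (flipTouch (endsD ends d)
              {x : V | x ∈ M2 (endsD ends d) r s ω ∧ x ≠ r ∧ x ≠ s} ω) d ∪
            K2 (endsD ends d) r s (flipTouch (endsD ends d)
              {x : V | x ∈ M2 (endsD ends d) r s ω ∧ x ≠ r ∧ x ≠ s} ω) ∪
            M2 (endsD ends d) r s (flipTouch (endsD ends d)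
              {x : V | x ∈ M2 (endsD ends d) r s ω ∧ x ≠ r ∧ x ≠ s} ω)) then
          flipTouch (endsD ends d) {x : V | x ∈ M2 (endsD ends d) r s ω ∧ x ≠ r ∧ x ≠ s} ω e
          else false) = ρ)).filter
        (fun ω => ∀ C ∈ comps (endsD ends d) r s ρ,
          (↑C : Set V) ⊆ {x : V | x ∈ M2 (endsD ends d) r s ω ∧ x ≠ r ∧ x ≠ s} →
          (∀ e y, y ∈ C → ends e ≠ s(r, y)) ∨ (∀ e y, y ∈ C → ends e ≠ s(s, y))),
      sigma ends ω p q * sigma ends ω r s ≤ 0 := by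
  have hR := mem_R_iff (ends := ends) (r := r) (s := s) (d := d) (ρ := ρ)
  have h𝔉K := famNL_subset_K2 (ends := ends) (d := d) hB
  have key := sum_prod_fibre_HD_nonpos_T (p := p) (q := q) hdr hds hrs hM hsep hD hK hB
    hR h𝔉K famNL_notMem_r famNL_notMem_s famNL_closedIn famNL_free famNL_pocket famNL_disjoint
    famNL_nl
  refine sum_fibre_nonpos_of_bij key (fun ω => univ.filter (fun i =>
    (∀ c, i = Sum.inl c →
      (↑c.1 : Set V) ⊆ {x : V | x ∈ M2 (endsD ends d) r s ω ∧ x ≠ r ∧ x ≠ s}) ∧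
    ∀ e, i = Sum.inr e → ω e.1 = true)) mem_univ_index ?_ ?_ ?_ ?_
  · intro ω hω
    rw [Finset.mem_filter, Finset.mem_filter, Finset.mem_filter] at hω
    obtain ⟨⟨⟨_, hHD⟩, hρω⟩, hNL⟩ := hω
    obtain ⟨hsepω, hDω, hKω, hMω, _⟩ := HD_konly_iff.1 hHD
    exact prod_index_eq_T hdr hds hsepω hDω hKω hMω hp hq hρω.symm hR h𝔉K
      (famNL_mem_of_wside hdr hds hsepω hDω hKω hMω hρω.symm hNL) _
      (fun i => Finset.mem_filter.trans (and_iff_right (Finset.mem_univ i)))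
  · intro S
    ext i
    exact (Finset.mem_filter.trans (and_iff_right (Finset.mem_univ i))).trans
      (index_prod_iff_T hdr hds hrs hM hsep hB hR h𝔉K famNL_notMem_r famNL_notMem_s famNL_closedIn
        famNL_disjoint famNL_nonempty S i).symm
  · intro ω hω
    rw [Finset.mem_filter, Finset.mem_filter, Finset.mem_filter] at hω
    exact (HD_konly_iff.1 hω.1.1.2).2.2.2.2
  · intro S hS
    rw [Finset.mem_filter, Finset.mem_filter, Finset.mem_filter]
    refine ⟨⟨⟨Finset.mem_univ _, HD_konly_iff.2 ⟨sep2_prod_T hdr hds hrs hM hsep hD hK hB hR h𝔉K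
      famNL_notMem_r famNL_notMem_s famNL_closedIn famNL_free famNL_pocket S hp hq,
      DOne_prod_T hdr hds hrs hM hsep hD hB hR h𝔉K famNL_notMem_r famNL_notMem_s famNL_closedIn
        famNL_free famNL_pocket S,
      d_mem_K2_prod_T hdr hds hrs hM hsep hK hB hR h𝔉K famNL_notMem_r famNL_notMem_s
        famNL_closedIn famNL_free S,
      d_notMem_M2_prod_T hdr hds hrs hM hsep hB hR h𝔉K famNL_notMem_r famNL_notMem_s
        famNL_closedIn famNL_free S, hS⟩⟩,
      skel_prod_eq_T hdr hds hrs hM hsep hB hρR hR h𝔉K famNL_notMem_r famNL_notMem_s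
        famNL_closedIn S⟩, ?_⟩
    -- the `W`-side of the point `φ S` is the union of its switched blocks, all non-linking
    intro C hC hCW
    rw [wside_prod_eq_T hdr hds hrs hM hsep hB hR h𝔉K famNL_notMem_r famNL_notMem_s famNL_closedIn
      S] at hCW
    obtain ⟨y, hy, rfl⟩ := Finset.mem_image.1 hC
    have hyC : y ∈ compIn (endsD ends d) (↑(A0 (endsD ends d) r s ρ) : Set V) y :=
      mem_compIn_self _ y
    obtain ⟨c, _, hyc⟩ := hCW (Finset.mem_coe.2 hyC)
    have hcC : c.1 = compIn (endsD ends d) (↑(A0 (endsD ends d) r s ρ) : Set V) y :=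
      eq_compIn_of_mem_comps (famNL_mem_comps c.1 c.2) hyc
    rw [← hcC]
    exact famNL_nl c.1 c.2

end Subcube

end NoPocket

end Summit.Ventures.PercRepro2
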